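import Summits.ResolutionOfSingularities.ResolutionOfSingularities.Theorems.WeightedInvariantContactLevelArcs
import HarnessLib

/-!
# Kernel certificate of DESIGN NOTE «E8»: `f = z² + y³ + x⁷` — the (ord, b_max) pair RISES along its own centre

Route `ResolutionOfSingularities/WeightedInvariant`, crux `Theses.WeightedInvariant.HypersurfaceCentreConstruction`
(stmt-ResolutionOfSingularities-19897), door line `local-engine`, KEY `stub_localWeightedDropEFT4S`, P3 design (Krull dimension 3):
res-L1-w43-plan-1 DEALS gen 10 #3 (2) DESIGN NOTE «E8» (hand computation, 2026-08-27T10:36Z) — «at ISOLATED tame top points a single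
INTEGER contact slope cannot be the P3 point rule»; kernel certificate ordered in DEALS gen 10 #5 (2) (res-type-057; carrier per
res-type-073: `OriginLocalization k 3 = k[x,y,z]_{(x,y,z)}`, ANY field `k`, no characteristic hypothesis).

NUMBERS ONLY (no word on the design): for `f = z² + y³ + x⁷ ∈ S = k[x,y,z]_{(x,y,z)}`:
* `adicOrder_f : ord f = 2`, `not_isMonomialType_f`, and **`bMax_f : b_max f = 1`** — NO regular parameter `g ∈ 𝔪 ∖ 𝔪²` carries
  `f` to contact level `2` (`not_reaches_f`, for every level `b ≥ 2`), so res-type-092's `jContact` centre at this position is the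
  closed point with weights `(1,1,1)` (the `𝔪`-adic filtration);
* `chart_identity : F(x, x y, x z) = x² · F₁(x, y, z)` with `F₁ = z² + x y³ + x⁵` — the strict transform in the `x`-chart of the
  blow-up of that point;
* `adicOrder_f₁ : ord f₁ = 2` (the order STALLS) and **`bMax_f₁ : b_max f₁ = 2`** (`reaches_f₁_two` with the contact parameter `z`;
  `not_reaches_f₁_three`): the pair `(ord, b_max)` reads `(2,1) → (2,2)` — `e8_summary`.
CAUTION (res-type-073, 2026-08-27T10:52Z): the game clause reads `ι` at primes of the cobordant blow-up algebra
`S[t⁻¹, x t, y t, z t]` (Krull dimension 4); `k[x, y′, z′]_0` here is the classical `x`-chart of the point blow-up (the weight-one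
slice), which is where plan-1's hand computation lives — this file certifies exactly that computation.

METHOD (`…ContactLevelArcs`): a reached contact level `f ∈ ⨆ⱼ (gʲ)·𝔪^{bν − bj}` is refuted by ONE arc `γ` through the origin
with `g ∘ γ ∈ (t)^c` and `f ∘ γ ∉ (t)^N`, `N ≤ min_j (c j + (bν − bj))`; the regular parameter `g = (Σ Xᵢ Qᵢ)/s` has a
non-zero linear part `(Qᵢ(0))ᵢ`, and a case split on it chooses the arc (linear arcs kill the linear part to first order; in the
one delicate case — `g = a z + (order ≥ 2)`, the contact parameter of level 2 «up to φ» — a second-order arc `(t, 0, z₂ t²)` kills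
`g ∘ γ` to order 3 while `f₁ ∘ γ = z₂² t⁴ + t⁵`).

Helper (`--supports stmt-ResolutionOfSingularities-19897`); OURS design bookkeeping, no claim about resolution in positive
characteristic and no statement of any manuscript under review.  AI-written; weaker than expert review.
[cite: CossartJannsenSaito2020, Ch. 8] [cite: ZariskiSamuel1960, Ch. VIII §1]
-/

noncomputable section

set_option linter.dupNamespace false -- mandated namespace of this single-conjunct summit

open IsLocalRing MvPolynomial
open Literature.AlgebraicGeometry.Resolution
open Summit.ResolutionOfSingularities.ResolutionOfSingularities.Theorems

namespace Summit.ResolutionOfSingularities.ResolutionOfSingularities.Cruxes.HypersurfaceCentreConstruction.LocalEngine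

/-! ## The specimen E8: `f = z² + y³ + x⁷` and its point-blow-up transform `f₁ = z² + x y³ + x⁵` in `k[x,y,z]_0` -/

namespace ContactLevelE8

open ContactLevelArcs

variable (k : Type) [Field k]

/-- `F = z² + y³ + x⁷ ∈ k[x,y,z]` (`x = X 0`, `y = X 1`, `z = X 2`). -/
abbrev F : MvPolynomial (Fin 3) k := X 2 ^ 2 + X 1 ^ 3 + X 0 ^ 7

/-- `F₁ = z² + x y³ + x⁵ ∈ k[x,y,z]` — the strict transform of `F` in the `x`-chart of the blow-up of the origin
(`F(x, x y, x z) = x² F₁(x, y, z)`, see `chart_identity`). -/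
abbrev F₁ : MvPolynomial (Fin 3) k := X 2 ^ 2 + X 0 * X 1 ^ 3 + X 0 ^ 5

/-- `f = F/1 ∈ S = k[x,y,z]_{(x,y,z)}`. -/
abbrev f : OriginLocalization k 3 := algebraMap (MvPolynomial (Fin 3) k) (OriginLocalization k 3) (F k)

/-- `f₁ = F₁/1 ∈ S`. -/
abbrev f₁ : OriginLocalization k 3 := algebraMap (MvPolynomial (Fin 3) k) (OriginLocalization k 3) (F₁ k)

/-- **The `x`-chart identity of the point blow-up**: `F(x, x y, x z) = x² · F₁(x, y, z)` in every commutative ring. [folklore] -/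
theorem chart_identity {R : Type*} [CommRing R] (x y z : R) :
    (x * z) ^ 2 + (x * y) ^ 3 + x ^ 7 = x ^ 2 * (z ^ 2 + x * y ^ 3 + x ^ 5) := by
  ring

/-- The variables lie in the origin ideal. [folklore] -/
theorem X_mem_originIdeal (i : Fin 3) : (X i : MvPolynomial (Fin 3) k) ∈ originIdeal k 3 := by
  simp

/-- The variables are in `𝔪`. [folklore] -/
theorem algebraMap_X_mem (i : Fin 3) :
    algebraMap (MvPolynomial (Fin 3) k) (OriginLocalization k 3) (X i) ∈ maximalIdeal (OriginLocalization k 3) := by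
  rw [← Localization.AtPrime.map_eq_maximalIdeal]
  exact Ideal.mem_map_of_mem _ (X_mem_originIdeal k i)

/-! ### Substitution of arcs into `F`, `F₁` -/

/-- `F` along a linear arc `γᵢ = cᵢ t`. [folklore] -/
theorem aeval_linearArc_F (c : Fin 3 → k) :
    MvPolynomial.aeval (fun i => PowerSeries.C (c i) * PowerSeries.X) (F k) =
      PowerSeries.C (c 2 ^ 2) * PowerSeries.X ^ 2 + PowerSeries.C (c 1 ^ 3) * PowerSeries.X ^ 3 +
        PowerSeries.C (c 0 ^ 7) * PowerSeries.X ^ 7 := by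
  simp only [map_add, map_pow, MvPolynomial.aeval_X]
  ring

/-- `F₁` along a linear arc `γᵢ = cᵢ t`. [folklore] -/
theorem aeval_linearArc_F₁ (c : Fin 3 → k) :
    MvPolynomial.aeval (fun i => PowerSeries.C (c i) * PowerSeries.X) (F₁ k) =
      PowerSeries.C (c 2 ^ 2) * PowerSeries.X ^ 2 + PowerSeries.C (c 0 * c 1 ^ 3) * PowerSeries.X ^ 4 +
        PowerSeries.C (c 0 ^ 5) * PowerSeries.X ^ 5 := by
  simp only [map_add, map_pow, map_mul, MvPolynomial.aeval_X]
  ring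

/-- The `t²` and `t³` coefficients of `F` along a linear arc. [folklore] -/
theorem coeff_aeval_linearArc_F (c : Fin 3 → k) :
    PowerSeries.coeff 2 (MvPolynomial.aeval (fun i => PowerSeries.C (c i) * PowerSeries.X) (F k)) = c 2 ^ 2 ∧
    PowerSeries.coeff 3 (MvPolynomial.aeval (fun i => PowerSeries.C (c i) * PowerSeries.X) (F k)) = c 1 ^ 3 := by
  rw [aeval_linearArc_F]
  constructor <;> · simp only [map_add, PowerSeries.coeff_C_mul_X_pow]; simp

/-- The `t²` coefficient of `F₁` along a linear arc. [folklore] -/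
theorem coeff_aeval_linearArc_F₁ (c : Fin 3 → k) :
    PowerSeries.coeff 2 (MvPolynomial.aeval (fun i => PowerSeries.C (c i) * PowerSeries.X) (F₁ k)) = c 2 ^ 2 := by
  rw [aeval_linearArc_F₁]
  simp only [map_add, PowerSeries.coeff_C_mul_X_pow]
  simp

/-! ### Orders -/

/-- `f ∈ 𝔪²`. [folklore] -/
theorem f_mem_sq : f k ∈ maximalIdeal (OriginLocalization k 3) ^ 2 := by
  rw [← Localization.AtPrime.map_eq_maximalIdeal, ← Ideal.map_pow]
  refine Ideal.mem_map_of_mem _ (Ideal.add_mem _ (Ideal.add_mem _ (Ideal.pow_mem_pow (X_mem_originIdeal k 2) 2) ?_) ?_)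
  · exact Ideal.pow_le_pow_right (by norm_num) (Ideal.pow_mem_pow (X_mem_originIdeal k 1) 3)
  · exact Ideal.pow_le_pow_right (by norm_num) (Ideal.pow_mem_pow (X_mem_originIdeal k 0) 7)

/-- `f₁ ∈ 𝔪²`. [folklore] -/
theorem f₁_mem_sq : f₁ k ∈ maximalIdeal (OriginLocalization k 3) ^ 2 := by
  rw [← Localization.AtPrime.map_eq_maximalIdeal, ← Ideal.map_pow]
  refine Ideal.mem_map_of_mem _ (Ideal.add_mem _ (Ideal.add_mem _ (Ideal.pow_mem_pow (X_mem_originIdeal k 2) 2) ?_) ?_)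
  · rw [pow_two]
    exact Ideal.mul_mem_mul (X_mem_originIdeal k 0)
      (Ideal.pow_le_self (by norm_num) (Ideal.pow_mem_pow (X_mem_originIdeal k 1) 3))
  · exact Ideal.pow_le_pow_right (by norm_num) (Ideal.pow_mem_pow (X_mem_originIdeal k 0) 5)

/-- Test along a linear arc: an element of `𝔪^N` goes to `(t)^N`. [folklore] -/
theorem coeff_eq_zero_of_mem_pow (c : Fin 3 → k) {p : MvPolynomial (Fin 3) k} {N : ℕ}
    (hp : algebraMap (MvPolynomial (Fin 3) k) (OriginLocalization k 3) p ∈ maximalIdeal (OriginLocalization k 3) ^ N) :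
    ∀ m < N, PowerSeries.coeff m (MvPolynomial.aeval (fun i => PowerSeries.C (c i) * PowerSeries.X) p) = 0 := by
  obtain ⟨φ, hφ, hloc, -⟩ := exists_arcHom k (fun i => PowerSeries.C (c i) * PowerSeries.X) (constantCoeff_linearArc k c)
  have h := map_mem_pow_of_mem_pow φ hloc hp
  rw [hφ, mem_maximalIdeal_pow_iff] at h
  exact h

/-- `f ∉ 𝔪³` (along the arc `(0,0,t)`, `f ↦ t²`). [folklore] -/
theorem f_not_mem_cube : f k ∉ maximalIdeal (OriginLocalization k 3) ^ 3 := fun h => by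
  have h2 := coeff_eq_zero_of_mem_pow k ![0, 0, 1] h 2 (by norm_num)
  rw [(coeff_aeval_linearArc_F k _).1] at h2
  simp at h2

/-- `f₁ ∉ 𝔪³` (same arc). [folklore] -/
theorem f₁_not_mem_cube : f₁ k ∉ maximalIdeal (OriginLocalization k 3) ^ 3 := fun h => by
  have h2 := coeff_eq_zero_of_mem_pow k ![0, 0, 1] h 2 (by norm_num)
  rw [coeff_aeval_linearArc_F₁ k] at h2
  simp at h2

/-- `z ∉ 𝔪²` (arc `(0,0,t)`). [folklore] -/
theorem algebraMap_X_two_not_mem_sq :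
    algebraMap (MvPolynomial (Fin 3) k) (OriginLocalization k 3) (X 2) ∉ maximalIdeal (OriginLocalization k 3) ^ 2 :=
  fun h => by
  have h1 := coeff_eq_zero_of_mem_pow k ![0, 0, 1] h 1 (by norm_num)
  simp [MvPolynomial.aeval_X, PowerSeries.coeff_X] at h1

/-- **`ord f = 2`.** [folklore] -/
theorem adicOrder_f : adicOrder (f k) = 2 :=
  le_antisymm ((adicOrder_le_iff _ 2).mpr (f_not_mem_cube k)) ((le_adicOrder_iff _ 2).mpr (f_mem_sq k))

/-- **`ord f₁ = 2`** — the order does NOT drop at the origin of the `x`-chart. [folklore] -/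
theorem adicOrder_f₁ : adicOrder (f₁ k) = 2 :=
  le_antisymm ((adicOrder_le_iff _ 2).mpr (f₁_not_mem_cube k)) ((le_adicOrder_iff _ 2).mpr (f₁_mem_sq k))

/-! ### Regular parameters as fractions with a non-zero linear part -/

/-- A regular parameter `g ∈ 𝔪 ∖ 𝔪²` of `k[x]_0` is a fraction `(Σᵢ Xᵢ Qᵢ)/s` with SOME `Qᵢ(0) ≠ 0`. [folklore] -/
theorem exists_fraction_of_regular_parameter {n : ℕ} {g : OriginLocalization k n}
    (hg : g ∈ maximalIdeal (OriginLocalization k n)) (hg2 : g ∉ maximalIdeal (OriginLocalization k n) ^ 2) :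
    ∃ (Q : Fin n → MvPolynomial (Fin n) k) (s : (originIdeal k n).primeCompl),
      g = IsLocalization.mk' (OriginLocalization k n) (∑ i, MvPolynomial.X i * Q i) s ∧
      ∃ i, MvPolynomial.constantCoeff (Q i) ≠ 0 := by
  obtain ⟨⟨G, s⟩, hGs⟩ := IsLocalization.mk'_surjective (originIdeal k n).primeCompl g
  subst hGs
  have hG : G ∈ originIdeal k n :=
    (IsLocalization.AtPrime.mk'_mem_maximal_iff (OriginLocalization k n) (originIdeal k n) G s).mp hg
  obtain ⟨Q, rfl⟩ := exists_eq_sum_X_mul_of_mem_originIdeal k hG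
  refine ⟨Q, s, rfl, ?_⟩
  by_contra hall
  simp only [not_exists, ne_eq, not_not] at hall
  exact hg2 (mk'_mem_maximalIdeal_pow k (sum_X_mul_mem_sq k Q hall) s)

/-- The piece exponents of a reached level `b ≥ 2` (order `2`) dominate `4` along an arc with `g ∘ γ ∈ (t)²`. [folklore] -/
theorem four_le_pieces {b : ℕ} (hb : 2 ≤ b) : ∀ j : ℕ, 4 ≤ 2 * j + (b * 2 - b * j) := by
  intro j
  rcases j with _ | _ | j
  · omega
  · omega
  · omega

/-! ### `f = z² + y³ + x⁷`: no contact level `b ≥ 2` is reached -/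

/-- **No regular parameter carries `f = z² + y³ + x⁷` to a contact level `b ≥ 2`** (`f ∉ ⨆ⱼ (gʲ)·𝔪^{2b−bj}` for every
`g ∈ 𝔪 ∖ 𝔪²`).  Proof by ARCS: write `g = (Σ Xᵢ Qᵢ)/s` with linear part `(a₀, a₁, a₂) = (Qᵢ(0))ᵢ ≠ 0`; a linear arc `γ` through
the origin killing the linear part (`g ∘ γ ∈ (t)²`) forces `f ∘ γ ∈ (t)⁴` if the level were reached, while `f ∘ γ` has a
non-zero coefficient in degree `≤ 3` for the arcs `(−a₁/a₀·t, t, 0)` (`a₀ ≠ 0`), `(0, t, 0)` (`a₀ = a₁ = 0`), `(0, 0, t)`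
(`a₀ = a₂ = 0 ≠ a₁`), `(0, t, −a₁/a₂·t)` (`a₀ = 0`, `a₁ a₂ ≠ 0`). [folklore] -/
theorem not_reaches_f {b : ℕ} (hb : 2 ≤ b) : ¬ Reaches (f k) 2 b := by
  rintro ⟨g, hg, hg2, hf⟩
  obtain ⟨Q, s, rfl, hQ⟩ := exists_fraction_of_regular_parameter k hg hg2
  -- the test: a linear arc `γᵢ = cᵢ t` with `Σ cᵢ Qᵢ(0) = 0` kills the coefficients of `f ∘ γ` below `4`
  have test : ∀ (c : Fin 3 → k), (∑ i, c i * MvPolynomial.constantCoeff (Q i) = 0) →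
      ∀ m < 4, PowerSeries.coeff m (MvPolynomial.aeval (fun i => PowerSeries.C (c i) * PowerSeries.X) (F k)) = 0 := by
    intro c hc
    obtain ⟨φ, hφ, hloc, hfrac⟩ := exists_arcHom k (fun i => PowerSeries.C (c i) * PowerSeries.X)
      (constantCoeff_linearArc k c)
    have h4 : φ (f k) ∈ maximalIdeal (PowerSeries k) ^ 4 :=
      map_mem_pow_of_mem_contactFiltration φ hloc hf (hfrac _ s 2 (aeval_linearArc_mem_sq k c Q hc)) (four_le_pieces hb)
    rw [hφ, mem_maximalIdeal_pow_iff] at h4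
    exact h4
  by_cases h0 : MvPolynomial.constantCoeff (Q 0) = 0
  · by_cases h1 : MvPolynomial.constantCoeff (Q 1) = 0
    · -- `a₀ = a₁ = 0`: arc `(0, t, 0)`, `f ∘ γ = t³ + …`
      have h := test ![0, 1, 0] (by simp [Fin.sum_univ_three, h0, h1]) 3 (by norm_num)
      rw [(coeff_aeval_linearArc_F k _).2] at h
      simp at h
    · by_cases h2 : MvPolynomial.constantCoeff (Q 2) = 0
      · -- `a₀ = a₂ = 0 ≠ a₁`: arc `(0, 0, t)`, `f ∘ γ = t²`
        have h := test ![0, 0, 1] (by simp [Fin.sum_univ_three, h0, h2]) 2 (by norm_num)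
        rw [(coeff_aeval_linearArc_F k _).1] at h
        simp at h
      · -- `a₀ = 0`, `a₁ a₂ ≠ 0`: arc `(0, t, −a₁/a₂ · t)`, `t²`-coefficient `(a₁/a₂)² ≠ 0`
        have h := test ![0, 1, -(MvPolynomial.constantCoeff (Q 1) / MvPolynomial.constantCoeff (Q 2))]
          (by simp [Fin.sum_univ_three, h0]; field_simp; ring) 2 (by norm_num)
        rw [(coeff_aeval_linearArc_F k _).1] at h
        simp only [Matrix.cons_val_two, Matrix.tail_cons, Matrix.head_cons] at h
        exact h1 (by simpa [h2] using h)
  · -- `a₀ ≠ 0`: arc `(−a₁/a₀ · t, t, 0)`, `f ∘ γ = t³ + …`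
    have h := test ![-(MvPolynomial.constantCoeff (Q 1) / MvPolynomial.constantCoeff (Q 0)), 1, 0]
      (by simp [Fin.sum_univ_three]; field_simp; ring) 3 (by norm_num)
    rw [(coeff_aeval_linearArc_F k _).2] at h
    simp at h

/-- Level `1` is reached (contact parameter `z`). [folklore] -/
theorem reaches_f_one : Reaches (f k) 2 1 :=
  reaches_one (f_mem_sq k) ⟨_, algebraMap_X_mem k 2, algebraMap_X_two_not_mem_sq k⟩

/-- **`b_max(z² + y³ + x⁷) = 1`** in `k[x,y,z]_0`, every field `k`: the (iotaOrd, bMax) letter's contact centre at this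
position is the POINT, weights `(1,1,1)`. [folklore] -/
theorem bMax_f : bMax (f k) = 1 := by
  have hord : (adicOrder (f k)).toNat = 2 := by rw [adicOrder_f]; rfl
  refine bMax_eq_of_reaches_of_not_reaches_succ le_rfl ?_ ?_
  · rw [hord]; exact reaches_f_one k
  · rw [hord]; exact not_reaches_f k le_rfl

/-- **`f = z² + y³ + x⁷` is not of monomial type** (not a unit times a power of a regular parameter). [folklore] -/
theorem not_isMonomialType_f : ¬ IsMonomialType (f k) := by
  rintro ⟨v, g, ν, hv, hg, hg2, hfe⟩
  rcases Nat.lt_or_ge ν 3 with hν | hν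
  · interval_cases ν
    · -- `ν = 0`: `f` would be a unit
      have hmem : f k ∈ maximalIdeal (OriginLocalization k 3) := Ideal.pow_le_self two_ne_zero (f_mem_sq k)
      rw [hfe, pow_zero, mul_one] at hmem
      exact (IsLocalRing.mem_maximalIdeal _).mp hmem hv
    · -- `ν = 1`: `f = v g ∉ 𝔪²`
      apply hg2
      have h := f_mem_sq k
      rw [hfe, pow_one] at h
      exact (Ideal.unit_mul_mem_iff_mem _ hv).mp h
    · -- `ν = 2`: `f ∈ (g²)` would reach level `2`
      refine not_reaches_f k (le_refl 2) ⟨g, hg, hg2, ?_⟩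
      rw [contactFiltration_def]
      refine Ideal.mem_iSup_of_mem 2 ?_
      rw [show 2 * 2 - 2 * 2 = 0 from rfl, pow_zero, Ideal.one_eq_top, Ideal.mul_top, hfe, Ideal.mem_span_singleton]
      exact Dvd.intro_left v rfl
  · -- `ν ≥ 3`: `f ∈ 𝔪³`
    refine f_not_mem_cube k ?_
    rw [hfe]
    exact Ideal.mul_mem_left _ v (Ideal.pow_le_pow_right hν (Ideal.pow_mem_pow hg ν))

/-! ### `f₁ = z² + x y³ + x⁵`: level `2` is reached, level `3` is not -/

/-- **Level `2` IS reached by `f₁` with the contact parameter `z`**: `z² ∈ (z²)`, `x y³, x⁵ ∈ 𝔪⁴`. [folklore] -/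
theorem reaches_f₁_two : Reaches (f₁ k) 2 2 := by
  refine ⟨algebraMap _ _ (X 2), algebraMap_X_mem k 2, algebraMap_X_two_not_mem_sq k, ?_⟩
  rw [contactFiltration_def]
  have h4 : ∀ p ∈ originIdeal k 3 ^ 4, algebraMap (MvPolynomial (Fin 3) k) (OriginLocalization k 3) p ∈
      ⨆ j, Ideal.span {algebraMap (MvPolynomial (Fin 3) k) (OriginLocalization k 3) (X 2) ^ j} *
        maximalIdeal (OriginLocalization k 3) ^ (2 * 2 - 2 * j) := by
    intro p hp
    refine Ideal.mem_iSup_of_mem 0 ?_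
    rw [pow_zero, Ideal.span_singleton_one, Ideal.top_mul, show 2 * 2 - 2 * 0 = 4 from rfl,
      ← Localization.AtPrime.map_eq_maximalIdeal, ← Ideal.map_pow]
    exact Ideal.mem_map_of_mem _ hp
  rw [f₁, F₁, map_add, map_add]
  refine Ideal.add_mem _ (Ideal.add_mem _ ?_ (h4 _ ?_)) (h4 _ ?_)
  · refine Ideal.mem_iSup_of_mem 2 ?_
    rw [show 2 * 2 - 2 * 2 = 0 from rfl, pow_zero, Ideal.one_eq_top, Ideal.mul_top, map_pow]
    exact Ideal.mem_span_singleton_self _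
  · rw [show (4 : ℕ) = 1 + 3 from rfl, pow_add, pow_one]
    exact Ideal.mul_mem_mul (X_mem_originIdeal k 0) (Ideal.pow_mem_pow (X_mem_originIdeal k 1) 3)
  · exact Ideal.pow_le_pow_right (by norm_num) (Ideal.pow_mem_pow (X_mem_originIdeal k 0) 5)

/-- **No regular parameter carries `f₁ = z² + x y³ + x⁵` to contact level `3`** (`f₁ ∉ ⨆ⱼ (gʲ)·𝔪^{6−3j}` for every
`g ∈ 𝔪 ∖ 𝔪²`).  ARCS again, with linear part `(a₀,a₁,a₂)` of `g`: if `(a₀,a₁) ≠ 0` a linear arc with `z = t` killing the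
linear part gives `g ∘ γ ∈ (t)²` and `f₁ ∘ γ = t² + …`, while the level forces `(t)⁴`; if `a₀ = a₁ = 0` (`g = a₂ z + …` —
the level-2 contact parameter «up to `φ`») the SECOND-ORDER arc `(t, 0, −(q/a₂) t²)`, killing also the `t²`-coefficient
`q + a₂ z₂` of `g ∘ γ` (`q` = the `x²`-coefficient of the numerator), gives `g ∘ γ ∈ (t)³`, so the level would force
`f₁ ∘ γ ∈ (t)⁶`; but `f₁ ∘ γ = z₂² t⁴ + t⁵`. [folklore] -/
theorem not_reaches_f₁_three : ¬ Reaches (f₁ k) 2 3 := by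
  rintro ⟨g, hg, hg2, hf⟩
  obtain ⟨Q, s, rfl, hQ⟩ := exists_fraction_of_regular_parameter k hg hg2
  -- first-order test (linear arcs, `g ∘ γ ∈ (t)²` ⇒ `f₁ ∘ γ ∈ (t)⁴`)
  have test : ∀ (c : Fin 3 → k), (∑ i, c i * MvPolynomial.constantCoeff (Q i) = 0) →
      ∀ m < 4, PowerSeries.coeff m (MvPolynomial.aeval (fun i => PowerSeries.C (c i) * PowerSeries.X) (F₁ k)) = 0 := by
    intro c hc
    obtain ⟨φ, hφ, hloc, hfrac⟩ := exists_arcHom k (fun i => PowerSeries.C (c i) * PowerSeries.X)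
      (constantCoeff_linearArc k c)
    have h4 : φ (f₁ k) ∈ maximalIdeal (PowerSeries k) ^ 4 :=
      map_mem_pow_of_mem_contactFiltration φ hloc hf (hfrac _ s 2 (aeval_linearArc_mem_sq k c Q hc))
        (fun j => by omega)
    rw [hφ, mem_maximalIdeal_pow_iff] at h4
    exact h4
  by_cases h0 : MvPolynomial.constantCoeff (Q 0) = 0
  · by_cases h1 : MvPolynomial.constantCoeff (Q 1) = 0
    · -- `a₀ = a₁ = 0`, so `a₂ ≠ 0`: the second-order arc `(t, 0, z₂ t²)`
      have h2 : MvPolynomial.constantCoeff (Q 2) ≠ 0 := by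
        obtain ⟨i, hi⟩ := hQ
        fin_cases i
        · exact absurd h0 hi
        · exact absurd h1 hi
        · exact hi
      -- second decomposition `Q₀ = Σⱼ Xⱼ Pⱼ` (`Q₀(0) = a₀ = 0`)
      have hQ0 : Q 0 ∈ originIdeal k 3 := by rw [mem_originIdeal_iff]; exact h0
      obtain ⟨P, hP⟩ := exists_eq_sum_X_mul_of_mem_originIdeal k hQ0
      obtain ⟨z₂, hz₂⟩ : ∃ z₂ : k, MvPolynomial.constantCoeff (P 0) + z₂ * MvPolynomial.constantCoeff (Q 2) = 0 :=
        ⟨-(MvPolynomial.constantCoeff (P 0) / MvPolynomial.constantCoeff (Q 2)), by field_simp; ring⟩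
      let γ : Fin 3 → PowerSeries k := ![PowerSeries.X, 0, PowerSeries.C z₂ * PowerSeries.X ^ 2]
      have hγ : ∀ i, PowerSeries.constantCoeff (γ i) = 0 := fun i => by fin_cases i <;> simp [γ]
      obtain ⟨φ, hφ, hloc, hfrac⟩ := exists_arcHom k γ hγ
      -- `g ∘ γ ∈ (t)³`
      have hG : MvPolynomial.aeval γ (∑ i, MvPolynomial.X i * Q i) ∈ maximalIdeal (PowerSeries k) ^ 3 := by
        have hexp : MvPolynomial.aeval γ (∑ i, MvPolynomial.X i * Q i) =
            PowerSeries.X ^ 2 * (MvPolynomial.aeval γ (P 0) + PowerSeries.C z₂ * MvPolynomial.aeval γ (Q 2)) +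
              PowerSeries.X ^ 3 * (PowerSeries.C z₂ * MvPolynomial.aeval γ (P 2)) := by
          conv_lhs => rw [Fin.sum_univ_three, hP, Fin.sum_univ_three]
          simp only [map_add, map_mul, MvPolynomial.aeval_X, γ, Matrix.cons_val_zero, Matrix.cons_val_one,
            Matrix.cons_val_two, Matrix.head_cons, Matrix.tail_cons]
          ring
        rw [hexp]
        refine Ideal.add_mem _ (X_pow_mul_mem_maximalIdeal_pow_succ k 2 ?_) (X_pow_mul_mem_maximalIdeal_pow k 3 _)
        rw [map_add, map_mul, PowerSeries.constantCoeff_C, constantCoeff_aeval_arc k γ hγ, constantCoeff_aeval_arc k γ hγ]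
        exact hz₂
      have h6 : φ (f₁ k) ∈ maximalIdeal (PowerSeries k) ^ 6 :=
        map_mem_pow_of_mem_contactFiltration φ hloc hf (hfrac _ s 3 hG) (fun j => by omega)
      rw [hφ, mem_maximalIdeal_pow_iff] at h6
      -- `f₁ ∘ γ = z₂² t⁴ + t⁵`: the `t⁵`-coefficient is `1`
      have h := h6 5 (by norm_num)
      have hf₁ : MvPolynomial.aeval γ (F₁ k) = PowerSeries.C (z₂ ^ 2) * PowerSeries.X ^ 4 + PowerSeries.X ^ 5 := by
        simp only [F₁, map_add, map_pow, map_mul, MvPolynomial.aeval_X, γ, Matrix.cons_val_zero, Matrix.cons_val_one,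
          Matrix.cons_val_two, Matrix.head_cons, Matrix.tail_cons]
        ring
      rw [hf₁, map_add, PowerSeries.coeff_C_mul_X_pow, PowerSeries.coeff_X_pow] at h
      simp at h
    · -- `a₀ = 0 ≠ a₁`: arc `(0, −a₂/a₁ · t, t)`, `f₁ ∘ γ = t²`
      have h := test ![0, -(MvPolynomial.constantCoeff (Q 2) / MvPolynomial.constantCoeff (Q 1)), 1]
        (by simp [Fin.sum_univ_three, h0]; field_simp; ring) 2 (by norm_num)
      rw [coeff_aeval_linearArc_F₁ k] at h
      simp at h
  · -- `a₀ ≠ 0`: arc `(−a₂/a₀ · t, 0, t)`, `f₁ ∘ γ = t² + …`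
    have h := test ![-(MvPolynomial.constantCoeff (Q 2) / MvPolynomial.constantCoeff (Q 0)), 0, 1]
      (by simp [Fin.sum_univ_three]; field_simp; ring) 2 (by norm_num)
    rw [coeff_aeval_linearArc_F₁ k] at h
    simp at h

/-- **`b_max(z² + x y³ + x⁵) = 2`** in `k[x,y,z]_0`, every field `k` — at the origin of the `x`-chart the terminal contact
level RISES from `1` to `2` while the order stays `2`. [folklore] -/
theorem bMax_f₁ : bMax (f₁ k) = 2 := by
  have hord : (adicOrder (f₁ k)).toNat = 2 := by rw [adicOrder_f₁]; rfl
  refine bMax_eq_of_reaches_of_not_reaches_succ (by norm_num) ?_ ?_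
  · rw [hord]; exact reaches_f₁_two k
  · rw [hord]; exact not_reaches_f₁_three k

/-- **E8, packaged.**  In `k[x,y,z]_{(x,y,z)}` over ANY field: `f = z² + y³ + x⁷` has order `2`, terminal contact level
`b_max = 1` and is not of monomial type (so the (iotaOrd, bMax) letter's centre is the closed point with weights
`(1,1,1)`), and its `x`-chart transform `f₁ = z² + x y³ + x⁵` (`chart_identity`) has order `2` and `b_max = 2` at the origin
of the chart: the pair `(ord, b_max)` goes `(2,1) → (2,2)` — it does not decrease lexicographically. [folklore] -/
theorem e8_summary :
    adicOrder (f k) = 2 ∧ bMax (f k) = 1 ∧ ¬ IsMonomialType (f k) ∧ adicOrder (f₁ k) = 2 ∧ bMax (f₁ k) = 2 :=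
  ⟨adicOrder_f k, bMax_f k, not_isMonomialType_f k, adicOrder_f₁ k, bMax_f₁ k⟩

end ContactLevelE8

end Summit.ResolutionOfSingularities.ResolutionOfSingularities.Cruxes.HypersurfaceCentreConstruction.LocalEngine

end
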